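import Summits.ValiantsHypothesis.ValiantsHypothesis.Theorems.RigidMinimalRepsMinimalRepTorusSymmetricReduction
import Summits.ValiantsHypothesis.ValiantsHypothesis.Theorems.RigidMinimalRepsMinimalRepTorusSymmetricGrenetTight

/-!
# Crux `RigidMinimalReps.MinimalRepTorusSymmetric` (stmt-ValiantsHypothesis-5112) — calibration:
# the line's heart ≡ the crux ≡ the eventual Grenet lower bound `2ⁿ - 1 ≤ dc(per_n)`

Two equivalences, by tree theorems only (no named facts):

* `subPotentials_iff_minimalRepTorusSymmetric` — the statement of the remaining stub
  `stub_subPotentials` of the line `birth` ("for all large `n` SOME optimal affine determinantal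
  representation of `per_n` admits a two-sided sub-potential") is EQUIVALENT to the crux
  `X = MinimalRepTorusSymmetric`: (→) `minimalRepTorusSymmetric_of_subPotentials` (initial form +
  diagonal lifts, file `…Reduction.lean`), (←) `subPotentials_of_minimalRepTorusSymmetric` (proved
  `TorusBound` + Grenet's upper bound make Grenet's TIGHT matrix optimal, file `…GrenetTight.lean`).
  So the line `birth` is a reformulation of the crux with zero residual: its combinatorial shadow is
  the whole crux.
* `minimalRepTorusSymmetric_iff_grenetLowerEventually` — the crux itself is, verbatim up to tree
  theorems, the eventual exponential lower bound `∃ n₀, ∀ n ≥ n₀, 2ⁿ - 1 ≤ dc(per_n)` (eventual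
  optimality of Grenet's representation): (→) the proved sibling crux `TorusBound`
  (`torusBound_proof`); (←) Grenet's two-sided-torus-equivariant representation of size `2ⁿ - 1`
  (`Grenet.hasEquivariantDetRepr_perPoly_twoSidedTorus`) is then optimal.  (First checked as a crux
  workfile by the strategist seat, `Cruxes/MinimalRepTorusSymmetric/CruxCalibration.lean`; landed here
  so that it is importable.)
[cite: Grenet2011, Thm. 1] [cite: LandsbergRessayre2017, Thm. 2.8]
-/

-- Sub = Summit single-conjunct layout: the duplicated namespace component is mandated by the tree.
set_option linter.dupNamespace false

noncomputable section

namespace Summit.ValiantsHypothesis.ValiantsHypothesis.Theorems.RigidMinimalRepsMinimalRepTorusSymmetric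

open Matrix MvPolynomial Finset
open Literature.Computability.AlgebraicComplexity LRPencil

/-- **The line's heart is the crux.**  `stub_subPotentials` (some optimal representation of `per_n`,
`n` large, admits a two-sided sub-potential) ↔ `MinimalRepTorusSymmetric` (some optimal
representation is two-sided-torus equivariant). [cite: LandsbergRessayre2017, Thm. 2.8] -/
theorem subPotentials_iff_minimalRepTorusSymmetric :
    (∃ n₀ : ℕ, ∀ n ≥ n₀, ∀ s : ℕ, determinantalComplexity (perPoly (Fin n) ℂ) = s →
      ∃ A : Matrix (Fin s) (Fin s) (MvPolynomial (Fin n × Fin n) ℂ),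
        IsAffineDetRepr (perPoly (Fin n) ℂ) A ∧
        ∃ α β : Fin s → (Fin n → ℤ) × (Fin n → ℤ),
          (∀ i j, constPart A i j ≠ 0 → α i + β j ≤ 0) ∧
          (∀ i j (v : Fin n × Fin n), coeffMat A v i j ≠ 0 →
            α i + β j ≤ ((Pi.single v.1 1 : Fin n → ℤ), (Pi.single v.2 1 : Fin n → ℤ))) ∧
          ∑ i, α i + ∑ j, β j = 1) ↔
    Summit.ValiantsHypothesis.ValiantsHypothesis.Theses.RigidMinimalReps.MinimalRepTorusSymmetric :=
  ⟨minimalRepTorusSymmetric_of_subPotentials, subPotentials_of_minimalRepTorusSymmetric⟩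

/-- **The crux is the eventual Grenet lower bound.**  `MinimalRepTorusSymmetric ↔
∃ n₀, ∀ n ≥ n₀, 2ⁿ - 1 ≤ dc(per_n)`: (→) by the proved `TorusBound`; (←) Grenet's equivariant
representation of size `2ⁿ - 1` is then optimal (its generator set, all invertible `diag(d_k e_l)`,
contains the crux's, so equivariance restricts by `HasEquivariantDetRepr.anti`).
[cite: Grenet2011, Thm. 1] [cite: LandsbergRessayre2017, Thm. 2.8] -/
theorem minimalRepTorusSymmetric_iff_grenetLowerEventually :
    Summit.ValiantsHypothesis.ValiantsHypothesis.Theses.RigidMinimalReps.MinimalRepTorusSymmetric ↔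
    ∃ n₀ : ℕ, ∀ n ≥ n₀, 2 ^ n - 1 ≤ determinantalComplexity (perPoly (Fin n) ℂ) := by
  constructor
  · rintro ⟨n₀, h⟩
    refine ⟨max n₀ 3, fun n hn => ?_⟩
    obtain ⟨A, hA⟩ := h n (le_trans (le_max_left _ _) hn)
    exact RigidMinimalRepsTorusBound.torusBound_proof n (le_trans (le_max_right _ _) hn) _ A hA
  · rintro ⟨n₀, h⟩
    refine ⟨max n₀ 1, fun n hn => ?_⟩
    have hn1 : 1 ≤ n := le_trans (le_max_right _ _) hn
    have heq : determinantalComplexity (perPoly (Fin n) ℂ) = 2 ^ n - 1 :=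
      le_antisymm (determinantalComplexity_perPoly_le_holds ℂ n hn1)
        (h n (le_trans (le_max_left _ _) hn))
    rw [heq]
    refine (Grenet.hasEquivariantDetRepr_perPoly_twoSidedTorus ℂ (n := n) (by omega)).anti
      (Subgroup.closure_mono ?_)
    rintro γ ⟨d, e, -, -, hγ⟩
    exact ⟨d, e, hγ⟩

end Summit.ValiantsHypothesis.ValiantsHypothesis.Theorems.RigidMinimalRepsMinimalRepTorusSymmetric

end
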